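import Literature.Probability.Percolation.OneArmOSSSCovariance
import Literature.Probability.Percolation.HutchcroftVolumeLocal
import Literature.Probability.Percolation.SharpnessDCTProofs
import HarnessLib

/-!
# The OSSS one-arm inequality on `ℤ^d`, I: the box cube, the spheres `∂Λ_k` as seed sets, and the bridges

Source: H. Duminil-Copin, A. Raoufi, V. Tassion, Ann. of Math. 189 (2019), §3, Lemma 3.2 and the proof of
Thm 1.2 for `q = 1` (Bernoulli percolation); H. Duminil-Copin, *Sharp threshold phenomena in statistical
physics*, arXiv:1810.03384, Lemma 3.8: "we will rather choose a family of decision trees discovering the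
connected components of `∂Λ_k` for `1 ≤ k ≤ n` … As a key, we use that for `u ∈ Λ_n`,
`∑_{k=1}^n P_p[u ↔ ∂Λ_k] ≤ ∑_{k=1}^n P_p[u ↔ ∂Λ_{|k−d(u,0)|}(u)] ≤ 2 S_n`."

Lattice bookkeeping for `OneArmOSSSDiffIneqZd.lean`, on the box cube `PairIdx d n → Bool` of
`HutchcroftVolumeBoxCube.lean` (all pairs of `Λ_n` as coordinates, biases `p` on lattice edges and `0`
elsewhere) with the LATTICE incidence `latEdge` (only nearest-neighbour pairs are edges of the explored
graph, so that open paths of the cube are lattice paths for every input):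

* `latEdge`, `latEdge_symm`, `latEdge_ends`; the sup-norm `boxNorm` and its elementary properties;
* `separates_sphereSeed` — for `1 ≤ k ≤ n` the sphere `∂Λ_k = {‖v‖_∞ = k}` separates `0` from `∂Λ_n`
  (every lattice path from `0` to `∂Λ_n` meets `∂Λ_k`: discrete intermediate values);
* `sum_wt_garm_eq` — `∑_x w(x)·𝟙{0 ↔ ∂Λ_n}(x) = P_p(0 ↔ ∂Λ_n) = θ_n(p)`;
* `seedProb_sphereSeed_le` — `P_p(u ↔ ∂Λ_k in Λ_n) ≤ θ_{|k − ‖u‖_∞|}(p)` (first exit of the open path from `u`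
  out of `u + Λ_{|k−‖u‖|−1}`, translation invariance `DCT16.real_armEvent`);
* `real_pivotal_eq_pivArm` — `P_p(e ∈ E(ℤ^d), e pivotal for {0 ↔ ∂Λ_n}) = p_e-weighted cube pivotality`.
-/

noncomputable section

namespace Literature.Probability.Percolation

open _root_.MeasureTheory Finset Function Literature.Probability.LatticeModels
open Literature.Probability.ODonnellSaksSchrammServedio2005
open GhostExploration SeedExploration DCT16

namespace OneArmOSSS

variable {d : ℕ}

/-! ### The lattice incidence on the box cube -/

/-- LATTICE incidence of the box graph: the pair `{a, b}` if `a ∼ b` in `ℤ^d`, no label otherwise.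
[cite: DuminilCopinRaoufiTassion2019, §3 Lemma 3.2 (the finite graph G = (V,E); here Λ_n with its lattice edges)] -/
def latEdge (d n : ℕ) (a b : BoxV d n) : Option (PairIdx d n) :=
  if (zdGraph d).Adj a.1 b.1 then some ⟨s(a.1, b.1), Finset.mk_mem_sym2_iff.2 ⟨a.2, b.2⟩⟩ else none

/-- The lattice incidence is symmetric. [cite: DuminilCopinRaoufiTassion2019, §3 Lemma 3.2 (undirected graph)] -/
theorem latEdge_symm (n : ℕ) (a b : BoxV d n) : latEdge d n a b = latEdge d n b a := by
  unfold latEdge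
  by_cases h : (zdGraph d).Adj a.1 b.1
  · rw [if_pos h, if_pos h.symm]
    simp only [Option.some.injEq, Subtype.mk.injEq]
    exact Sym2.eq_swap
  · rw [if_neg h, if_neg (fun h' => h h'.symm)]

/-- A lattice label records the lattice adjacency and the pair.
[cite: DuminilCopinRaoufiTassion2019, §3 Lemma 3.2 (open edges of the graph)] -/
theorem latEdge_eq_some_iff {n : ℕ} {a b : BoxV d n} {e : PairIdx d n} :
    latEdge d n a b = some e ↔ (zdGraph d).Adj a.1 b.1 ∧ e.1 = s(a.1, b.1) := by
  unfold latEdge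
  constructor
  · intro h
    split_ifs at h with h1
    simp only [Option.some.injEq] at h
    exact ⟨h1, by rw [← h]⟩
  · rintro ⟨h1, h2⟩
    rw [if_pos h1]
    simp only [Option.some.injEq]
    exact Subtype.ext h2.symm

/-- Edge labels have unique endpoints. [cite: DuminilCopinRaoufiTassion2019, §3 Lemma 3.2 (simple graph)] -/
theorem latEdge_ends (n : ℕ) (e : PairIdx d n) (a b a' b' : BoxV d n) (h : latEdge d n a b = some e)
    (h' : latEdge d n a' b' = some e) : a' = a ∨ a' = b := by
  obtain ⟨_, h1⟩ := latEdge_eq_some_iff.1 h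
  obtain ⟨_, h2⟩ := latEdge_eq_some_iff.1 h'
  rw [h1] at h2
  rcases Sym2.eq_iff.1 h2 with ⟨h3, _⟩ | ⟨h3, h4⟩
  · exact Or.inl (Subtype.ext h3.symm)
  · exact Or.inr (Subtype.ext h4.symm)

/-! ### The sup norm on `ℤ^d` -/

/-- `‖x‖_∞ = max_i |x_i|` as a natural number ("`d(u,0)`" of the source).
[cite: DuminilCopinRaoufiTassion2019, §3 proof of Lemma 3.2 (the graph distance d(u,0); boxes Λ_k(x))] -/
def boxNorm (x : Site d) : ℕ := univ.sup fun i => (x i).natAbs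

/-- Each coordinate is bounded by the sup norm. [cite: DuminilCopinRaoufiTassion2019, §3 proof of Lemma 3.2 (the distance d(u,0) and the boxes Λ_k(x) of ℤ^d)] -/
theorem natAbs_le_boxNorm (x : Site d) (i : Fin d) : (x i).natAbs ≤ boxNorm x :=
  Finset.le_sup (f := fun i => (x i).natAbs) (mem_univ i)

/-- `‖x‖_∞ ≤ n ↔ ∀ i, |x_i| ≤ n`. [cite: DuminilCopinRaoufiTassion2019, §3 proof of Lemma 3.2 (the distance d(u,0) and the boxes Λ_k(x) of ℤ^d)] -/
theorem boxNorm_le_iff {x : Site d} {n : ℕ} : boxNorm x ≤ n ↔ ∀ i, (x i).natAbs ≤ n := by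
  simp [boxNorm, Finset.sup_le_iff]

/-- `x ∈ Λ_n ↔ ‖x‖_∞ ≤ n`. [cite: DuminilCopinRaoufiTassion2019, §3 proof of Lemma 3.2 (the distance d(u,0) and the boxes Λ_k(x) of ℤ^d)] -/
theorem mem_box_iff_boxNorm_le {x : Site d} {n : ℕ} : x ∈ box d n ↔ boxNorm x ≤ n := by
  rw [mem_box, boxNorm_le_iff]
  refine forall_congr' fun i => ?_
  omega

/-- `‖0‖_∞ = 0`. [cite: DuminilCopinRaoufiTassion2019, §3 proof of Lemma 3.2 (the distance d(u,0) and the boxes Λ_k(x) of ℤ^d)] -/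
theorem boxNorm_zero : boxNorm (0 : Site d) = 0 := by
  apply Nat.eq_zero_of_le_zero
  rw [boxNorm_le_iff]; intro i; simp

/-- `‖x − y‖_∞ = ‖y − x‖_∞`. [cite: DuminilCopinRaoufiTassion2019, §3 proof of Lemma 3.2 (the distance d(u,0) and the boxes Λ_k(x) of ℤ^d)] -/
theorem boxNorm_sub_comm (x y : Site d) : boxNorm (x - y) = boxNorm (y - x) := by
  unfold boxNorm
  congr 1; ext i
  simp only [Pi.sub_apply]
  omega

/-- Triangle inequality `‖x + y‖_∞ ≤ ‖x‖_∞ + ‖y‖_∞`. [cite: DuminilCopinRaoufiTassion2019, §3 proof of Lemma 3.2 (the distance d(u,0) and the boxes Λ_k(x) of ℤ^d)] -/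
theorem boxNorm_add_le (x y : Site d) : boxNorm (x + y) ≤ boxNorm x + boxNorm y := by
  rw [boxNorm_le_iff]
  intro i
  have h1 := natAbs_le_boxNorm x i
  have h2 := natAbs_le_boxNorm y i
  simp only [Pi.add_apply]
  omega

/-- Reverse triangle inequality in distance form: `|‖u‖_∞ − ‖a‖_∞| ≤ ‖u − a‖_∞`.
[cite: DuminilCopinRaoufiTassion2019, §3 proof of Lemma 3.2 (u ↔ ∂Λ_k forces u ↔ ∂Λ_{|k−d(u,0)|}(u))] -/
theorem dist_boxNorm_le (u a : Site d) : Nat.dist (boxNorm u) (boxNorm a) ≤ boxNorm (u - a) := by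
  have h1 : boxNorm u ≤ boxNorm (u - a) + boxNorm a := by
    have := boxNorm_add_le (u - a) a; rwa [sub_add_cancel] at this
  have h2 : boxNorm a ≤ boxNorm (a - u) + boxNorm u := by
    have := boxNorm_add_le (a - u) u; rwa [sub_add_cancel] at this
  rw [boxNorm_sub_comm a u] at h2
  unfold Nat.dist
  omega

/-- A lattice step changes the sup norm by at most one. [cite: DuminilCopinRaoufiTassion2019, §3 proof of Lemma 3.2 (the distance d(u,0) and the boxes Λ_k(x) of ℤ^d)] -/
theorem boxNorm_le_succ_of_adj {x y : Site d} (h : (zdGraph d).Adj x y) : boxNorm y ≤ boxNorm x + 1 := by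
  rw [boxNorm_le_iff]
  intro j
  have hj := natAbs_le_boxNorm x j
  rw [zdGraph_adj_iff] at h
  obtain ⟨i, h | h⟩ := h
  · have : y j = x j + (Pi.single i (1 : ℤ) : Site d) j := by rw [h]; simp
    rw [this]
    by_cases hji : j = i
    · subst hji; simp; omega
    · simp [hji]; omega
  · have : y j = x j - (Pi.single i (1 : ℤ) : Site d) j := by rw [h]; simp
    rw [this]
    by_cases hji : j = i
    · subst hji; simp; omega
    · simp [hji]; omega

/-- A vertex of the inner boundary of `Λ_n` has sup norm `n`. [cite: DuminilCopinRaoufiTassion2019, §3 proof of Lemma 3.2 (the distance d(u,0) and the boxes Λ_k(x) of ℤ^d)] -/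
theorem boxNorm_eq_of_mem_innerBoundary {n : ℕ} {x : Site d}
    (hx : x ∈ innerBoundary (zdGraph d) (box d n)) : boxNorm x = n := by
  rw [mem_innerBoundary_iff] at hx
  obtain ⟨hxb, y, hyb, hxy⟩ := hx
  have h1 := mem_box_iff_boxNorm_le.1 hxb
  have h2 : ¬ boxNorm y ≤ n := fun h => hyb (mem_box_iff_boxNorm_le.2 h)
  have h3 := boxNorm_le_succ_of_adj hxy
  omega

/-- A site of sup norm `≥ m` lies outside `Λ_m` or on its inner boundary (`d ≥ 1`).
[cite: DuminilCopinRaoufiTassion2019, §3 proof of Lemma 3.2 (u ↔ ∂Λ_{|k−d(u,0)|}(u))] -/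
theorem not_mem_box_or_mem_innerBoundary (hd : 1 ≤ d) {m : ℕ} {x : Site d} (hx : m ≤ boxNorm x) :
    x ∉ box d m ∨ x ∈ innerBoundary (zdGraph d) (box d m) := by
  by_cases hxm : x ∈ box d m
  · right
    have hle := mem_box_iff_boxNorm_le.1 hxm
    have heq : boxNorm x = m := le_antisymm hle hx
    -- a coordinate achieving the sup norm
    have hne : (univ : Finset (Fin d)).Nonempty := ⟨⟨0, hd⟩, mem_univ _⟩
    obtain ⟨i, -, hi⟩ := Finset.exists_mem_eq_sup univ hne (fun i => (x i).natAbs)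
    change boxNorm x = (x i).natAbs at hi
    rw [mem_innerBoundary_iff]
    refine ⟨hxm, ?_⟩
    by_cases hsgn : 0 ≤ x i
    · refine ⟨x + Pi.single i 1, fun hy => ?_, (zdGraph_adj_iff _ _).2 ⟨i, Or.inl rfl⟩⟩
      have := (mem_box.1 hy i).2
      simp at this; omega
    · refine ⟨x - Pi.single i 1, fun hy => ?_, (zdGraph_adj_iff _ _).2 ⟨i, Or.inr (by simp)⟩⟩
      have := (mem_box.1 hy i).1
      simp at this; omega
  · exact Or.inl hxm

/-! ### Source, targets and the seed spheres -/

/-- The origin of the box. [cite: DuminilCopinRaoufiTassion2019, §3 Lemma 3.2 (the vertex 0)] -/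
def origin (d n : ℕ) : BoxV d n := ⟨0, zero_mem_box d n⟩

/-- The targets `∂Λ_n` (inner vertex boundary of the box). [cite: DuminilCopinRaoufiTassion2019, §3 Lemma 3.2 (∂Λ_n)] -/
def bdryTarget (d n : ℕ) : Set (BoxV d n) := {v | v.1 ∈ innerBoundary (zdGraph d) (box d n)}

/-- The seed sphere `∂Λ_k = {v ∈ Λ_n : ‖v‖_∞ = k}`. [cite: DuminilCopinRaoufiTassion2019, §3 proof of Lemma 3.2 (V_0 = ∂Λ_k)] -/
def sphereSeed (d n k : ℕ) : Set (BoxV d n) := {v | boxNorm v.1 = k}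

/-- Open adjacency for the lattice incidence: a lattice edge of the box whose pair is open.
[cite: DuminilCopinRaoufiTassion2019, §3 Lemma 3.2 (open edges)] -/
theorem yAdj_latEdge_iff {n : ℕ} {y : PairIdx d n → Bool} {a b : BoxV d n} :
    YAdj (latEdge d n) y a b ↔ a ≠ b ∧ (zdGraph d).Adj a.1 b.1 ∧
      y ⟨s(a.1, b.1), Finset.mk_mem_sym2_iff.2 ⟨a.2, b.2⟩⟩ = true := by
  unfold YAdj
  refine and_congr_right fun _ => ?_
  constructor
  · rintro ⟨e, he, hy⟩
    obtain ⟨hadj, he1⟩ := latEdge_eq_some_iff.1 he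
    refine ⟨hadj, ?_⟩
    have : e = ⟨s(a.1, b.1), Finset.mk_mem_sym2_iff.2 ⟨a.2, b.2⟩⟩ := Subtype.ext he1
    rw [← this]; exact hy
  · rintro ⟨hadj, hy⟩
    exact ⟨_, latEdge_eq_some_iff.2 ⟨hadj, rfl⟩, hy⟩

/-- THE SPHERES SEPARATE: for `1 ≤ k ≤ n`, every open lattice path from `0` to `∂Λ_n` inside `Λ_n` passes
through `∂Λ_k` (the sup norm moves by at most one per step), so `∂Λ_k` separates `0` from `∂Λ_n` in the
sense of `SeedExploration.Separates`. [cite: DuminilCopinRaoufiTassion2019, §3 proof of Lemma 3.2 (T determines 𝟙_{0↔∂Λ_n} for 1 ≤ k ≤ n)] -/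
theorem separates_sphereSeed {n k : ℕ} (hk1 : 1 ≤ k) (hkn : k ≤ n) :
    Separates (latEdge d n) (sphereSeed d n k) (origin d n) (bdryTarget d n) := by
  intro y b hb hob
  -- invariant along the path from the origin
  have key : ∀ w : BoxV d n, YReach (latEdge d n) y (origin d n) w →
      boxNorm w.1 < k ∨ ∃ u ∈ sphereSeed d n k, YReach (latEdge d n) y u (origin d n) ∧
        YReach (latEdge d n) y u w := by
    intro w hw
    unfold YReach at hw
    induction hw with
    | refl => left; change boxNorm (0 : Site d) < k; rw [boxNorm_zero]; omega
    | @tail v w hv hvw ih =>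
      rcases ih with hlt | ⟨u, hu, huo, huv⟩
      · obtain ⟨_, hadj, _⟩ := yAdj_latEdge_iff.1 hvw
        have hstep := boxNorm_le_succ_of_adj hadj
        by_cases hwk : boxNorm w.1 < k
        · exact Or.inl hwk
        · right
          have hw : boxNorm w.1 = k := by omega
          refine ⟨w, hw, ?_, Relation.ReflTransGen.refl⟩
          exact yReach_symm (latEdge_symm n) (Relation.ReflTransGen.tail hv hvw)
      · right
        exact ⟨u, hu, huo, Relation.ReflTransGen.tail huv hvw⟩
  rcases key b hob with hlt | h
  · have := boxNorm_eq_of_mem_innerBoundary hb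
    omega
  · exact h

/-! ### Bridges between cube paths and lattice paths -/

/-- An open path of the cube (lattice incidence) is an open lattice path inside `Λ_n` of the configuration.
[cite: DuminilCopinRaoufiTassion2019, §3 Lemma 3.2 (the events u ↔ ∂Λ_k inside Λ_n)] -/
theorem pathIn_of_yReach {n : ℕ} {ω : BondConfig (Site d)} {a b : BoxV d n}
    (h : YReach (latEdge d n) (toCube n ω) a b) : PathIn (openGraph ω) ↑(box d n) a.1 b.1 := by
  refine ⟨a.2, ?_⟩
  unfold YReach at h
  induction h with
  | refl => exact Relation.ReflTransGen.refl
  | @tail v w _ hvw ih =>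
    obtain ⟨hne, hadj, hy⟩ := yAdj_latEdge_iff.1 hvw
    refine Relation.ReflTransGen.tail ih ⟨?_, w.2⟩
    rw [openGraph_adj]
    simp only [toCube, decide_eq_true_eq] at hy
    exact ⟨hy, fun h => hne (Subtype.ext h)⟩

/-- Conversely, for a configuration of lattice edges, an open path inside `Λ_n` is an open path of the cube.
[cite: DuminilCopinRaoufiTassion2019, §3 Lemma 3.2 (the events u ↔ ∂Λ_k inside Λ_n)] -/
theorem yReach_of_pathIn {n : ℕ} {ω : BondConfig (Site d)} (hω : ω ⊆ (zdGraph d).edgeSet)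
    {a b : BoxV d n} (h : PathIn (openGraph ω) ↑(box d n) a.1 b.1) :
    YReach (latEdge d n) (toCube n ω) a b := by
  suffices H : ∀ y : Site d,
      Relation.ReflTransGen (fun u v => (openGraph ω).Adj u v ∧ v ∈ (↑(box d n) : Set (Site d))) a.1 y →
      ∀ hy : y ∈ box d n, YReach (latEdge d n) (toCube n ω) a ⟨y, hy⟩ from H b.1 h.2 b.2
  intro y hy
  induction hy with
  | refl => intro _; exact Relation.ReflTransGen.refl
  | @tail c e' hac hcd ih =>
    intro he'
    obtain ⟨hadj, _⟩ := hcd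
    rw [openGraph_adj] at hadj
    obtain ⟨hmem, hne⟩ := hadj
    have hc : c ∈ box d n := by
      rcases Relation.ReflTransGen.cases_tail hac with h0 | ⟨b', _, hcb⟩
      · rw [h0]; exact a.2
      · exact hcb.2
    have hlat : (zdGraph d).Adj c e' := by
      have := hω hmem
      rwa [SimpleGraph.mem_edgeSet] at this
    refine Relation.ReflTransGen.tail (ih hc)
      (yAdj_latEdge_iff.2 ⟨fun h => hne (congrArg Subtype.val h), hlat, ?_⟩)
    simp only [toCube, decide_eq_true_eq]
    exact hmem

/-- `𝟙{0 ↔ ∂Λ_n}` read on the cube implies the one-arm event `siteToBoundary`.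
[cite: DuminilCopinRaoufiTassion2019, §3 Lemma 3.2 (the event 0 ↔ ∂Λ_n)] -/
theorem mem_siteToBoundary_of_conn {n : ℕ} {ω : BondConfig (Site d)}
    (h : Conn (latEdge d n) (origin d n) (bdryTarget d n) (toCube n ω)) : ω ∈ siteToBoundary d n := by
  obtain ⟨b, hb, hr⟩ := h
  rw [mem_siteToBoundary_iff]
  exact ⟨b.1, hb, pathIn_of_yReach hr⟩

/-- For configurations of lattice edges, the one-arm event is `𝟙{0 ↔ ∂Λ_n}` read on the cube.
[cite: DuminilCopinRaoufiTassion2019, §3 Lemma 3.2 (the event 0 ↔ ∂Λ_n)] -/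
theorem conn_of_mem_siteToBoundary {n : ℕ} {ω : BondConfig (Site d)} (hω : ω ⊆ (zdGraph d).edgeSet)
    (h : ω ∈ siteToBoundary d n) : Conn (latEdge d n) (origin d n) (bdryTarget d n) (toCube n ω) := by
  rw [mem_siteToBoundary_iff] at h
  obtain ⟨y, hy, hpath⟩ := h
  have hyb : y ∈ box d n := (mem_innerBoundary_iff.1 hy).1
  exact ⟨⟨y, hyb⟩, hy, yReach_of_pathIn hω (a := origin d n) (b := ⟨y, hyb⟩) hpath⟩

/-- `P_p{0 ↔ ∂Λ_n read on the cube} = P_p(0 ↔ ∂Λ_n)` (the two events agree on configurations of lattice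
edges, a full-measure set). [cite: DuminilCopinRaoufiTassion2019, §3 proof of Thm 1.2 (θ_n = μ[0 ↔ ∂Λ_n])] -/
theorem real_setOf_conn_eq (n : ℕ) (p : unitInterval) :
    (bondPercolation (zdGraph d) p).real {ω | Conn (latEdge d n) (origin d n) (bdryTarget d n) (toCube n ω)}
      = (bondPercolation (zdGraph d) p).real (siteToBoundary d n) := by
  refine le_antisymm (measureReal_mono (fun ω hω => mem_siteToBoundary_of_conn hω)) ?_
  exact real_mono_of_forall_subset_edgeSet (zdGraph d) p fun ω hω h => conn_of_mem_siteToBoundary hω h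

/-- THE FIRST BRIDGE: `∑_x w(x)·𝟙{0 ↔ ∂Λ_n}(x) = P_p(0 ↔ ∂Λ_n)`.
[cite: DuminilCopinRaoufiTassion2019, §3 proof of Thm 1.2 (θ_n = μ[0 ↔ ∂Λ_n])] -/
theorem sum_wt_garm_eq (n : ℕ) (p : unitInterval) :
    ∑ x : PairIdx d n → Bool, wt (boxBias d n p) x * garm (latEdge d n) (origin d n) (bdryTarget d n) x
      = (bondPercolation (zdGraph d) p).real (siteToBoundary d n) := by
  classical
  rw [← real_setOf_conn_eq n p,
    real_setOf_toCube n p (fun x => Conn (latEdge d n) (origin d n) (bdryTarget d n) x)]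
  rfl

/-- THE REVEALMENT BRIDGE: `P_p(u ↔ ∂Λ_k inside Λ_n) ≤ θ_{|k − ‖u‖_∞|}(p)` — an open path from `u` to a site of
sup norm `k` leaves `u + Λ_{m−1}`, `m = |k − ‖u‖_∞|`, hence produces the translated arm event `armEvent u m`,
whose probability is `θ_m` by translation invariance. [cite: DuminilCopinRaoufiTassion2019, §3 proof of Lemma 3.2 (∑_k μ[u↔∂Λ_k] ≤ ∑_k μ[u ↔ ∂Λ_{|k−d(u,0)|}(u)])] -/
theorem seedProb_sphereSeed_le (hd : 1 ≤ d) (n : ℕ) (p : unitInterval) (k : ℕ) (a : BoxV d n) :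
    seedProb (latEdge d n) (boxBias d n p) (sphereSeed d n k) a
      ≤ (bondPercolation (zdGraph d) p).real (siteToBoundary d (Nat.dist k (boxNorm a.1))) := by
  classical
  unfold seedProb
  rw [← real_setOf_toCube n p (fun x => SeedConn (latEdge d n) (sphereSeed d n k) x a),
    ← real_armEvent p a.1 (Nat.dist k (boxNorm a.1))]
  refine real_mono_of_forall_subset_edgeSet (zdGraph d) p fun ω hω h => ?_
  obtain ⟨u, hu, hua⟩ := h
  have hau : YReach (latEdge d n) (toCube n ω) a u := yReach_symm (latEdge_symm n) hua
  have hpath := pathIn_of_yReach hau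
  refine armEvent_of_pathIn hω hpath (not_mem_box_or_mem_innerBoundary hd ?_)
  have h1 := dist_boxNorm_le u.1 a.1
  change boxNorm u.1 = k at hu
  rw [hu] at h1
  exact h1

/-! ### The pivotality bridge -/

/-- `𝟙{0 ↔ ∂Λ_n}` on the cube is increasing: opening pairs preserves the connection.
[cite: DuminilCopinRaoufiTassion2019, §3 Lemma 3.2 (𝟙_{0↔∂Λ_n} increasing)] -/
theorem conn_mono {n : ℕ} {x x' : PairIdx d n → Bool} (hle : ∀ e, x e = true → x' e = true)
    (h : Conn (latEdge d n) (origin d n) (bdryTarget d n) x) :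
    Conn (latEdge d n) (origin d n) (bdryTarget d n) x' := by
  obtain ⟨b, hb, hr⟩ := h
  exact ⟨b, hb, yReach_mono hle hr⟩

/-- THE PIVOTALITY BRIDGE: for a pair `e` of the box which is a lattice edge,
`P_p(e pivotal for {0 ↔ ∂Λ_n}) = ∑_y w(y)·(𝟙(y^{e→1}) − 𝟙(y^{e→0}))`; together with the factor `[e ∈ E(ℤ^d)]`
of Russo's formula. [cite: DuminilCopinRaoufiTassion2019, §3 proof of Thm 1.2 (derivative formula θ_n' = ∑_e Cov/p(1−p))] -/
theorem real_pivotal_eq_pivArm (n : ℕ) (p : unitInterval) (e : PairIdx d n) (he : e.1 ∈ (zdGraph d).edgeSet) :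
    (bondPercolation (zdGraph d) p).real {ω | e.1 ∈ (zdGraph d).edgeSet ∧ IsPivotal (siteToBoundary d n) e.1 ω}
      = pivArm (latEdge d n) (boxBias d n p) (origin d n) (bdryTarget d n) e := by
  classical
  set P : (PairIdx d n → Bool) → Prop := fun x => Conn (latEdge d n) (origin d n) (bdryTarget d n) x with hP
  -- Step 1: replace the one-arm event by its cube reading (they agree on lattice configurations)
  have hae : (bondPercolation (zdGraph d) p).real
      {ω | e.1 ∈ (zdGraph d).edgeSet ∧ IsPivotal (siteToBoundary d n) e.1 ω}
      = (bondPercolation (zdGraph d) p).real {ω | IsPivotal {ω | P (toCube n ω)} e.1 ω} := by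
    have hiff : ∀ ω, ω ⊆ (zdGraph d).edgeSet →
        (IsPivotal (siteToBoundary d n) e.1 ω ↔ IsPivotal {ω | P (toCube n ω)} e.1 ω) := by
      intro ω hω
      have h1 : insert e.1 ω ⊆ (zdGraph d).edgeSet := Set.insert_subset he hω
      have h2 : ω \ {e.1} ⊆ (zdGraph d).edgeSet := fun x hx => hω hx.1
      have e1 : insert e.1 ω ∈ siteToBoundary d n ↔ insert e.1 ω ∈ {ω | P (toCube n ω)} :=
        ⟨conn_of_mem_siteToBoundary h1, mem_siteToBoundary_of_conn⟩
      have e2 : ω \ {e.1} ∈ siteToBoundary d n ↔ ω \ {e.1} ∈ {ω | P (toCube n ω)} :=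
        ⟨conn_of_mem_siteToBoundary h2, mem_siteToBoundary_of_conn⟩
      unfold IsPivotal
      rw [e1, e2]
    refine le_antisymm ?_ ?_
    · exact real_mono_of_forall_subset_edgeSet (zdGraph d) p fun ω hω h => (hiff ω hω).1 h.2
    · exact real_mono_of_forall_subset_edgeSet (zdGraph d) p fun ω hω h => ⟨he, (hiff ω hω).2 h⟩
  rw [hae]
  -- Step 2: the cube pivotality event, as in `real_pivotal_locVol_eq`
  have hmono : ∀ x : PairIdx d n → Bool, P (update x e false) → P (update x e true) := by
    intro x h
    refine conn_mono (fun e' he' => ?_) h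
    by_cases hee : e' = e
    · subst hee; simp at he'
    · rwa [update_of_ne hee] at he' ⊢
  have hev : {ω : BondConfig (Site d) | IsPivotal {ω | P (toCube n ω)} e.1 ω}
      = {ω | P (update (toCube n ω) e true) ∧ ¬ P (update (toCube n ω) e false)} := by
    ext ω
    simp only [Set.mem_setOf_eq, IsPivotal, toCube_insert, toCube_sdiff]
    constructor
    · intro h
      rcases h with ⟨h1, h2⟩ | ⟨h1, h2⟩
      · exact ⟨h1, h2⟩
      · exact absurd (hmono _ h1) h2
    · rintro ⟨h1, h2⟩
      exact Or.inl ⟨h1, h2⟩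
  rw [hev, real_setOf_toCube n p (fun x => P (update x e true) ∧ ¬ P (update x e false))]
  unfold pivArm
  refine Finset.sum_congr rfl fun x _ => ?_
  congr 1
  unfold garm
  by_cases h1 : P (update x e true) <;> by_cases h0 : P (update x e false)
  · rw [if_pos h1, if_pos h0, if_neg (fun h => h.2 h0)]; ring
  · rw [if_pos h1, if_neg h0, if_pos ⟨h1, h0⟩]; ring
  · exact absurd (hmono x h0) h1
  · rw [if_neg h1, if_neg h0, if_neg (fun h => h1 h.1)]; ring

/-- Pairs of the box that are not lattice edges are never pivotal edges of `ℤ^d`: their Russo term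
vanishes. [cite: Russo1981, §4 Lemma 3 (only coordinates of the product space contribute)] -/
theorem real_pivotal_eq_zero_of_not_mem (n : ℕ) (p : unitInterval) (e : PairIdx d n)
    (he : e.1 ∉ (zdGraph d).edgeSet) :
    (bondPercolation (zdGraph d) p).real {ω | e.1 ∈ (zdGraph d).edgeSet ∧ IsPivotal (siteToBoundary d n) e.1 ω}
      = 0 := by
  have : {ω : BondConfig (Site d) | e.1 ∈ (zdGraph d).edgeSet ∧ IsPivotal (siteToBoundary d n) e.1 ω} = ∅ := by
    ext ω; simp [he]
  rw [this, measureReal_empty]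

end OneArmOSSS

end Literature.Probability.Percolation
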